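import Summits.RiemannHypothesis.RiemannHypothesis.Theorems.GroundBartaEvenWinsBeyondArchPhantomCertificateSound
import Literature.NumberTheory.LFunctions.WeilTwoPrimeCertificateDeflated
import HarnessLib

/-!
# RiemannHypothesis / GroundBarta machinery — PHANTOM CERTIFICATES: the deflated (rank-one augmented) checker `checkR`

Helper file (`--supports stmt-RiemannHypothesis-18085`; infrastructure for the Weil-positivity ladder), RH-free, axioms
standard.  Seat rh-explicit-weil-1.  The complement certificate `(β)` of the deflated Temple / Lehmann–Maehly L-side
(`WeilCert23.checkR`, `WeilTwoPrimeCertificateDeflated.lean`: `β‖g‖² ≤ E₂₃(g) + Σ μ_i |Σ_k ĉ_{ik} M_k(g)|²` on `C(b)`) for the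
PHANTOM format `WeilCert23X`: same block machinery (`WeilCert.checkBlockP`, `WeilCert.core_nonnegR`, generic in the tree), the
analytic reduction `WeilCert23X.margin_step3` (boosted level `wL`, combined minorant `γ_X`), Bessel weight `κ − β`.

* `WeilCert23X.checkR`, `WeilCert23X.checkRX_spec`;
* **`WeilCert23X.weilTwoPrimeQuadratic_rankOne_bound_of_checkR`** — `c.checkR β R = true →` (level of `w₂₃ + P` beyond `T`) `→`
  `β ‖g‖₂² ≤ E₂₃(g) + Σ μ |Σ ĉ M|²` on `C(b)`.
Everything here is proved; no named facts.
-/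

set_option linter.dupNamespace false

noncomputable section

open Complex Finset MeasureTheory Set Filter
open scoped Real Topology ComplexConjugate BigOperators

namespace Summit.RiemannHypothesis.RiemannHypothesis.Theorems.EvenWinsBeyondArch

open Literature.NumberTheory.LFunctions

open Literature.Analysis.ValidatedNumerics.Numerics
open Literature.Analysis.SpecialFunctions

namespace WeilCert23X

variable (c : WeilCert23X)

/-- **The checker of the rank-one augmented phantom certificate** for the claim `β‖g‖² ≤ E₂₃(g) + Σ μ|Σ ĉ M|²` on `C(b)`:
cells (old chain at `wL₀` and lattice-ripple chain), admissibility, scalars, moment table as in `check`; `β ≤ κ`; both blocks of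
`P_r + Σ μ ĉ ĉᵀ` with Bessel weight `κ − β`. [folklore] -/
def checkR (β : ℚ) (R : List (ℚ × ℕ × List ℚ)) : Bool :=
  checkCells₂₃ c.base.prec c.j c.base.wL c.base.T c.base.mwT c.cells && checkXCells c.rs c.base.T c.xcells &&
    c.checkRipples && c.checkScalars && c.checkNu && decide (β ≤ c.kappaQ) &&
    c.base.checkBlockP (fun k l ↦ c.base.prQ c.nuTab k l + rankOneQ R k l) (c.kappaQ - β) 0 &&
    c.base.checkBlockP (fun k l ↦ c.base.prQ c.nuTab k l + rankOneQ R k l) (c.kappaQ - β) 1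

variable {c}

/-- Unpacking `checkR`. [folklore] -/
theorem checkRX_spec {β : ℚ} {R : List (ℚ × ℕ × List ℚ)} (h : c.checkR β R = true) :
    checkCells₂₃ c.base.prec c.j c.base.wL c.base.T c.base.mwT c.cells = true ∧
      checkXCells c.rs c.base.T c.xcells = true ∧ c.checkRipples = true ∧ c.checkScalars = true ∧ c.checkNu = true ∧
      β ≤ c.kappaQ ∧
      c.base.checkBlockP (fun k l ↦ c.base.prQ c.nuTab k l + rankOneQ R k l) (c.kappaQ - β) 0 = true ∧
      c.base.checkBlockP (fun k l ↦ c.base.prQ c.nuTab k l + rankOneQ R k l) (c.kappaQ - β) 1 = true := by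
  unfold checkR at h
  simp only [Bool.and_eq_true, decide_eq_true_eq] at h
  exact ⟨h.1.1.1.1.1.1.1, h.1.1.1.1.1.1.2, h.1.1.1.1.1.2, h.1.1.1.1.2, h.1.1.1.2, h.1.1.2, h.1.2, h.2⟩

/-- **Soundness of the rank-one augmented (deflated) phantom certificate.**  If `c.checkR β R = true` and the boosted level holds
for `w₂₃ + P` beyond `T`, then for every test function `g` supported in `[-b, b]`:
`β ‖g‖₂² ≤ E₂₃(g) + Σ_{(μ,q,ĉ) ∈ R} μ |Σ_{k ≤ N} ĉ_k M_k(g)|²`, `M_k(g) = ∫ g(x)(x/a₀)^k dx`. [folklore] -/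
theorem weilTwoPrimeQuadratic_rankOne_bound_of_checkR {β : ℚ} {R : List (ℚ × ℕ × List ℚ)} (h : c.checkR β R = true)
    (hlevel : ∀ t : ℝ, (c.base.T : ℝ) ≤ |t| → (c.wL : ℝ) ≤ weilTwoPrimeWeight t + ripplesVal c.rs t)
    {g : ℝ → ℂ} (hg : IsWeilTest g) (hsupp : tsupport g ⊆ Icc (-(c.b : ℝ)) c.b) :
    (β : ℝ) * weilNorm2Sq g ≤ weilTwoPrimeQuadratic g +
      (R.map fun r ↦ (r.1 : ℝ) * ‖∑ k ∈ range (c.base.N + 1),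
        ((maskV r k : ℚ) : ℂ) * weilMoment c.base.a0 g k‖ ^ 2).sum := by
  obtain ⟨hcells3, hxc, hrip, hsc, hnuchk, hβ, hb0, hb1⟩ := checkRX_spec h
  obtain ⟨hbpos, -, hba, -, hT, -, -, hN, -⟩ := scalarsX_spec hsc
  have h23 : CellsOK₂₃ c.base.wL c.base.T c.cells := cellsOK_of_checkCells₂₃ hcells3
  have hX : XCellsOK c.rs c.base.T c.xcells := xCellsOK_of_checkXCells hxc
  have hadm := two_mul_b_le_abs_rippleFreq hX hT hrip
  have hb0' : (0 : ℝ) < c.b := by exact_mod_cast hbpos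
  have hba' : ((c.b : ℚ) : ℝ) ≤ (c.base.a0 : ℝ) := by exact_mod_cast hba
  have ha : (0 : ℝ) < (c.base.a0 : ℝ) := by linarith
  have hsupp' : tsupport g ⊆ Icc (-(c.base.a0 : ℝ)) c.base.a0 := hsupp.trans (Icc_subset_Icc (by linarith) hba')
  have step3 := margin_step3 h23 hX hadm hlevel hsc hnuchk hg hsupp
  have hbes := weilNorm2Sq_ge_bessel hg ha hsupp' (c.base.N + 1) (c.base.uVec (weilMoment c.base.a0 g))
  have hcore := WeilCert.core_nonnegR (c := c.base) (nu := c.nuTab) (κ := c.kappaQ - β) R hN hb0 hb1 _ rfl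
    (weilMoment c.base.a0 g)
  have hκ' : (0 : ℝ) ≤ ((c.kappaQ - β : ℚ) : ℝ) := by exact_mod_cast sub_nonneg.2 hβ
  have h4 := mul_le_mul_of_nonneg_left hbes hκ'
  push_cast at hcore h4 ⊢
  nlinarith [step3, hcore, h4]

/-- **Deflated soundness from parts**: the same bound from `CellsOK₂₃`, `XCellsOK` and the remaining Boolean checks (for landed
chains and per-chunk kernel facts). [folklore] -/
theorem weilTwoPrimeQuadratic_rankOne_bound_of_parts {β : ℚ} {R : List (ℚ × ℕ × List ℚ)}
    (h23 : CellsOK₂₃ c.base.wL c.base.T c.cells) (hX : XCellsOK c.rs c.base.T c.xcells)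
    (hrip : c.checkRipples = true) (hsc : c.checkScalars = true) (hnuchk : c.checkNu = true) (hβ : β ≤ c.kappaQ)
    (hb0 : c.base.checkBlockP (fun k l ↦ c.base.prQ c.nuTab k l + rankOneQ R k l) (c.kappaQ - β) 0 = true)
    (hb1 : c.base.checkBlockP (fun k l ↦ c.base.prQ c.nuTab k l + rankOneQ R k l) (c.kappaQ - β) 1 = true)
    (hlevel : ∀ t : ℝ, (c.base.T : ℝ) ≤ |t| → (c.wL : ℝ) ≤ weilTwoPrimeWeight t + ripplesVal c.rs t)
    {g : ℝ → ℂ} (hg : IsWeilTest g) (hsupp : tsupport g ⊆ Icc (-(c.b : ℝ)) c.b) :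
    (β : ℝ) * weilNorm2Sq g ≤ weilTwoPrimeQuadratic g +
      (R.map fun r ↦ (r.1 : ℝ) * ‖∑ k ∈ range (c.base.N + 1),
        ((maskV r k : ℚ) : ℂ) * weilMoment c.base.a0 g k‖ ^ 2).sum := by
  obtain ⟨hbpos, -, hba, -, hT, -, -, hN, -⟩ := scalarsX_spec hsc
  have hadm := two_mul_b_le_abs_rippleFreq hX hT hrip
  have hb0' : (0 : ℝ) < c.b := by exact_mod_cast hbpos
  have hba' : ((c.b : ℚ) : ℝ) ≤ (c.base.a0 : ℝ) := by exact_mod_cast hba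
  have ha : (0 : ℝ) < (c.base.a0 : ℝ) := by linarith
  have hsupp' : tsupport g ⊆ Icc (-(c.base.a0 : ℝ)) c.base.a0 := hsupp.trans (Icc_subset_Icc (by linarith) hba')
  have step3 := margin_step3 h23 hX hadm hlevel hsc hnuchk hg hsupp
  have hbes := weilNorm2Sq_ge_bessel hg ha hsupp' (c.base.N + 1) (c.base.uVec (weilMoment c.base.a0 g))
  have hcore := WeilCert.core_nonnegR (c := c.base) (nu := c.nuTab) (κ := c.kappaQ - β) R hN hb0 hb1 _ rfl
    (weilMoment c.base.a0 g)
  have hκ' : (0 : ℝ) ≤ ((c.kappaQ - β : ℚ) : ℝ) := by exact_mod_cast sub_nonneg.2 hβ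
  have h4 := mul_le_mul_of_nonneg_left hbes hκ'
  push_cast at hcore h4 ⊢
  nlinarith [step3, hcore, h4]

end WeilCert23X

end Summit.RiemannHypothesis.RiemannHypothesis.Theorems.EvenWinsBeyondArch

end
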